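import Summits.CriticalPhenomena.SAWScalingLimit.Theses.SAWBrickWallHomotopy
import Literature.Probability.RandomPlanarGeometry.ConformalRestrictionCovariance
import Literature.Probability.RandomPlanarGeometry.SLEExistenceNeEightHolds
import Literature.Probability.RandomPlanarGeometry.LatticeSimilarityCovariance
import HarnessLib

/-!
# Stub `stub_linearPinning` of line `pin-the-shear` (crux stmt-CriticalPhenomena-14221,
# `Theses.SAWPhaseRetrieval.HexTransfer`)

**Linear pinning: GL₂⁺-rigidity of the chordal SLE(8/3) law family modulo stretch rigidity.**
The line shows that the `δℤ²` SAW limit is `Φ ∘ SLE(8/3)` for ONE unidentified real-linear `Φ` of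
positive determinant, and that the conjugated quarter-turn `Ψ = Φ⁻¹ R Φ` (linear, `det = 1`) is a
covariance of the chordal SLE(8/3) law family. This file proves: given the axis-stretch rigidity
`SAWBrickWallHomotopy.StretchRigidity` (item stmt-CriticalPhenomena-5793, a hypothesis here), every
real-linear covariance of positive determinant of the SLE(8/3) law family is a rotation-dilation
(`m₁₁ = m₂₂`, `m₁₂ = -m₂₁`).

Proof. Write the linear map in complex form `z ↦ A z + B z̄` (`det = |A|² − |B|² > 0`); the goal is
`B = 0`. The class `G` of covariances contains the rotation-dilations `z ↦ c z` (conformal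
covariance of the SLE laws, `IsSLELaw.conformalCovariance_holds`, at the similarity conformal
equivalence, with existence of the SLE(8/3) law of the image domain, `exists_isSLECurve_eightThirds`)
and is closed under composition (`MarkedDomain.map_map`, `Measure.map_map`,
`CurveClass.map_homeomorph_trans`). Pre-composing with `z ↦ c₁ z` and post-composing with
`z ↦ c₂ z` turns `(A, B)` into `(c₂ A c₁, c₂ B c̄₁)`; with `c₁² = B Ā` (a complex square root) and
`c₂ = t · conj (A c₁)`, `t = 1 / (|A|² |B| (|A| + |B|))`, both become the REAL numbers
`|A| / (|A| + |B|)` and `|B| / (|A| + |B|)`, i.e. the composite is the axis stretch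
`z ↦ Re z + i s Im z` with `s = (|A| − |B|) / (|A| + |B|) ∈ (0, 1]`, identified with any homeomorphism
of that pointwise formula by `Homeomorph.ext`. Stretch rigidity gives `s = 1`, i.e. `|B| = 0`.

* `linear_eq_mul_add_mul_conj`, `stretch_eq_mul_add_mul_conj` : complex forms of real-linear maps;
* `eq_zero_of_stretchRigid_class` : the abstract rigidity lemma for a class of plane homeomorphisms
  containing the rotation-dilations and closed under composition;
* `isSLELaw_map_similarity_eightThirds`, `isSLELaw_map_trans_eightThirds` : the two closure
  properties of the SLE(8/3) covariances;
* `stub_linearPinning` : the registered stub, verbatim.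
-/

noncomputable section

namespace Summit.CriticalPhenomena.SAWScalingLimit.Cruxes.HexTransfer.PinTheShear

open MeasureTheory
open scoped NNReal ComplexConjugate
open Literature.Probability.RandomPlanarGeometry
open Summit.CriticalPhenomena.SAWScalingLimit.Theses

/-! ### Complex form of real-linear maps of the plane -/

/-- A real-linear map of the plane with matrix `(m₁₁ m₁₂; m₂₁ m₂₂)` is `z ↦ A z + B z̄` with
`A = ((m₁₁ + m₂₂) + i (m₂₁ − m₁₂)) / 2`, `B = ((m₁₁ − m₂₂) + i (m₂₁ + m₁₂)) / 2`. [folklore] -/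
theorem linear_eq_mul_add_mul_conj (m₁₁ m₁₂ m₂₁ m₂₂ : ℝ) (z : ℂ) :
    ((m₁₁ * z.re + m₁₂ * z.im : ℝ) : ℂ) + ((m₂₁ * z.re + m₂₂ * z.im : ℝ) : ℂ) * Complex.I =
      (⟨(m₁₁ + m₂₂) / 2, (m₂₁ - m₁₂) / 2⟩ : ℂ) * z +
        (⟨(m₁₁ - m₂₂) / 2, (m₂₁ + m₁₂) / 2⟩ : ℂ) * conj z := by
  apply Complex.ext <;> simp <;> ring

/-- The axis stretch `z ↦ Re z + i s Im z` is `z ↦ ((1 + s) / 2) z + ((1 − s) / 2) z̄`; here with the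
two real coefficients `p`, `q` subject to `p + q = 1`, `p − q = s`. [folklore] -/
theorem stretch_eq_mul_add_mul_conj {s p q : ℝ} (hpq : p + q = 1) (hs : p - q = s) (z : ℂ) :
    (z.re : ℂ) + ((s * z.im : ℝ) : ℂ) * Complex.I = (p : ℂ) * z + (q : ℂ) * conj z := by
  apply Complex.ext
  · simp only [Complex.add_re, Complex.ofReal_re, Complex.mul_re, Complex.I_re, mul_zero,
      Complex.ofReal_im, Complex.I_im, mul_one, sub_self, add_zero, Complex.conj_re,
      Complex.conj_im, mul_neg, sub_neg_eq_add, zero_mul, sub_zero]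
    linear_combination -(z.re * hpq)
  · simp only [Complex.add_im, Complex.ofReal_im, Complex.mul_im, Complex.I_re, mul_zero,
      Complex.ofReal_re, Complex.I_im, mul_one, add_zero, zero_add, Complex.conj_re,
      Complex.conj_im, mul_neg, zero_mul]
    linear_combination -(z.im * hs)

/-! ### The abstract rigidity lemma -/

/-- **Rigidity of a stretch-rigid class of plane homeomorphisms.** Let `P` be a class of plane
homeomorphisms containing every rotation-dilation `z ↦ c z` (`c ≠ 0`), closed under composition,
and STRETCH-RIGID: whenever every homeomorphism with the pointwise formula `z ↦ Re z + i s Im z`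
(`s > 0`) is in `P`, then `s = 1`. If a homeomorphism `Φ ∈ P` is the real-linear map
`z ↦ A z + B z̄` with `|B| < |A|` (positive determinant), then `B = 0`, i.e. `Φ` is a
rotation-dilation. (Singular-value decomposition in complex form: with `c₁² = B Ā` and
`c₂ = conj (A c₁) / (|A|² |B| (|A| + |B|))` the composite `c₂ Φ(c₁ z)` is the axis stretch of ratio
`(|A| − |B|) / (|A| + |B|)`.) [folklore] -/
theorem eq_zero_of_stretchRigid_class {P : (ℂ ≃ₜ ℂ) → Prop}
    (hK : ∀ (c : ℂ) (hc : c ≠ 0), P (similarity c hc 0))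
    (hmul : ∀ Ψ₁ Ψ₂ : ℂ ≃ₜ ℂ, P Ψ₁ → P Ψ₂ → P (Ψ₁.trans Ψ₂))
    (hSR : ∀ s : ℝ, 0 < s →
      (∀ Φ : ℂ ≃ₜ ℂ, (∀ z : ℂ, Φ z = (z.re : ℂ) + ((s * z.im : ℝ) : ℂ) * Complex.I) → P Φ) →
        s = 1)
    {A B : ℂ} (hAB : ‖B‖ < ‖A‖) {Φ : ℂ ≃ₜ ℂ} (hΦ : ∀ z : ℂ, Φ z = A * z + B * conj z)
    (hP : P Φ) : B = 0 := by
  by_contra hB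
  set a : ℝ := ‖A‖ with ha_def
  set b : ℝ := ‖B‖ with hb_def
  have hb : 0 < b := norm_pos_iff.2 hB
  have ha : 0 < a := hb.trans hAB
  have hA : A ≠ 0 := norm_pos_iff.1 ha
  -- a complex square root `c₁` of `B Ā`
  obtain ⟨c₁, hc₁⟩ := IsAlgClosed.exists_pow_nat_eq (B * conj A) two_pos
  have hc₁n : ‖c₁‖ ^ 2 = b * a := by
    rw [← norm_pow, hc₁, norm_mul, Complex.norm_conj]
  have hc₁0 : c₁ ≠ 0 := by
    rintro rfl
    rw [norm_zero, zero_pow two_ne_zero] at hc₁n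
    exact (mul_pos hb ha).ne' hc₁n.symm
  -- the normalising scalar and the post-composed rotation-dilation
  set t : ℝ := 1 / (a ^ 2 * b * (a + b)) with ht
  have htpos : 0 < t := by positivity
  set c₂ : ℂ := conj A * conj c₁ * (t : ℂ) with hc₂
  have hc₂0 : c₂ ≠ 0 := by
    refine mul_ne_zero (mul_ne_zero ?_ ?_) (Complex.ofReal_ne_zero.2 htpos.ne')
    · exact (map_ne_zero (starRingEnd ℂ)).2 hA
    · exact (map_ne_zero (starRingEnd ℂ)).2 hc₁0
  -- the algebraic relations
  have R1 : conj c₁ ^ 2 = conj B * A := by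
    have h := congrArg conj hc₁
    rwa [map_pow, map_mul, Complex.conj_conj] at h
  have R2 : A * conj A = (a : ℂ) ^ 2 := Complex.mul_conj' A
  have R3 : B * conj B = (b : ℂ) ^ 2 := Complex.mul_conj' B
  have R4 : c₁ * conj c₁ = (b : ℂ) * (a : ℂ) := by
    rw [Complex.mul_conj', ← Complex.ofReal_pow, hc₁n, Complex.ofReal_mul]
  have R5r : t * (a ^ 2 * b * (a + b)) = 1 := by
    rw [ht]
    field_simp
  have R5 : (t : ℂ) * ((a : ℂ) ^ 2 * (b : ℂ) * ((a : ℂ) + (b : ℂ))) = 1 := by exact_mod_cast R5r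
  have key₁ : c₂ * A * c₁ * ((a : ℂ) + (b : ℂ)) = (a : ℂ) := by
    rw [hc₂]
    linear_combination ((t : ℂ) * (c₁ * conj c₁) * ((a : ℂ) + (b : ℂ))) * R2 +
      ((t : ℂ) * (a : ℂ) ^ 2 * ((a : ℂ) + (b : ℂ))) * R4 + (a : ℂ) * R5
  have key₂ : c₂ * B * conj c₁ * ((a : ℂ) + (b : ℂ)) = (b : ℂ) := by
    rw [hc₂]
    linear_combination ((t : ℂ) * conj A * B * ((a : ℂ) + (b : ℂ))) * R1 +
      ((t : ℂ) * (B * conj B) * ((a : ℂ) + (b : ℂ))) * R2 +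
      ((t : ℂ) * (a : ℂ) ^ 2 * ((a : ℂ) + (b : ℂ))) * R3 + (b : ℂ) * R5
  have hab : (a : ℂ) + (b : ℂ) ≠ 0 := by exact_mod_cast (add_pos ha hb).ne'
  -- the two real coefficients of the composite
  set p : ℝ := a / (a + b) with hp
  set q : ℝ := b / (a + b) with hq
  have hpC : c₂ * A * c₁ = (p : ℂ) := by
    rw [hp, Complex.ofReal_div, Complex.ofReal_add, eq_div_iff hab, key₁]
  have hqC : c₂ * B * conj c₁ = (q : ℂ) := by
    rw [hq, Complex.ofReal_div, Complex.ofReal_add, eq_div_iff hab, key₂]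
  have hpq : p + q = 1 := by
    rw [hp, hq]
    field_simp
  -- the stretch ratio
  set s : ℝ := (a - b) / (a + b) with hs_def
  have hs : 0 < s := div_pos (sub_pos.2 hAB) (add_pos ha hb)
  have hpqs : p - q = s := by
    rw [hp, hq, hs_def]
    field_simp
  -- every homeomorphism with the stretch formula is the composite `c₂ Φ (c₁ ·)`, hence in `P`
  have hPs : ∀ Φ' : ℂ ≃ₜ ℂ,
      (∀ z : ℂ, Φ' z = (z.re : ℂ) + ((s * z.im : ℝ) : ℂ) * Complex.I) → P Φ' := by
    intro Φ' hΦ'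
    have hcomp : Φ' = (similarity c₁ hc₁0 0).trans (Φ.trans (similarity c₂ hc₂0 0)) := by
      ext1 z
      rw [hΦ', Homeomorph.trans_apply, Homeomorph.trans_apply, similarity_apply, similarity_apply,
        add_zero, add_zero, hΦ, stretch_eq_mul_add_mul_conj hpq hpqs z, ← hpC, ← hqC, map_mul]
      ring
    rw [hcomp]
    exact hmul _ _ (hK c₁ hc₁0) (hmul _ _ hP (hK c₂ hc₂0))
  have hs1 : s = 1 := hSR s hs hPs
  rw [hs_def, div_eq_one_iff_eq (add_pos ha hb).ne'] at hs1
  linarith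

/-! ### The SLE(8/3) covariances form such a class -/

/-- **Rotation-dilations are covariances of the chordal SLE(8/3) law family**: for `c ≠ 0` and
every SLE(8/3) law `μ` of a Dobrushin domain `D`, the push-forward of `μ` along `z ↦ c z` is an
SLE(8/3) law of the image domain `c D` (conformal covariance of the SLE laws,
`IsSLELaw.conformalCovariance_holds`, at the similarity conformal equivalence
`ChordalFamily.similarityConformalEquiv`; the SLE(8/3) law of `c D` exists by
`exists_isSLECurve_eightThirds`). [folklore] -/
theorem isSLELaw_map_similarity_eightThirds (c : ℂ) (hc : c ≠ 0) :
    ∀ (D : DobrushinDomain) (μ : Measure (CurveClass ℂ)), IsSLELaw ((8 : ℝ≥0) / 3) D μ →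
      IsSLELaw ((8 : ℝ≥0) / 3) (D.map (similarity c hc 0))
        (μ.map (CurveClass.map ((similarity c hc 0 : ℂ ≃ₜ ℂ) : C(ℂ, ℂ)))) := by
  intro D μ hμ
  obtain ⟨Γ', hΓ'⟩ := exists_isSLECurve_eightThirds (D.map (similarity c hc 0))
  have h0 := ChordalFamily.hasBoundaryValue_similarityConformalEquiv c hc 0 D.carrier (D.pt 0)
  have h1 := ChordalFamily.hasBoundaryValue_similarityConformalEquiv c hc 0 D.carrier (D.pt 1)
  rw [← IsSLELaw.conformalCovariance_holds D (D.map (similarity c hc 0))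
    (ChordalFamily.similarityConformalEquiv c hc 0 D.carrier) (similarity c hc 0 : C(ℂ, ℂ))
    hμ hΓ'.isSLELaw_map h0 h1 (fun _ _ => rfl)]
  exact hΓ'.isSLELaw_map

/-- **Covariances of the chordal SLE(8/3) law family compose**: if the plane homeomorphisms `Ψ₁`
and `Ψ₂` both push every SLE(8/3) law of every Dobrushin domain to an SLE(8/3) law of the image
domain, so does `Ψ₂ ∘ Ψ₁` (`MarkedDomain.map_map`, `Measure.map_map`,
`CurveClass.map_homeomorph_trans`). [folklore] -/
theorem isSLELaw_map_trans_eightThirds (Ψ₁ Ψ₂ : ℂ ≃ₜ ℂ)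
    (h₁ : ∀ (D : DobrushinDomain) (μ : Measure (CurveClass ℂ)), IsSLELaw ((8 : ℝ≥0) / 3) D μ →
      IsSLELaw ((8 : ℝ≥0) / 3) (D.map Ψ₁) (μ.map (CurveClass.map (Ψ₁ : C(ℂ, ℂ)))))
    (h₂ : ∀ (D : DobrushinDomain) (μ : Measure (CurveClass ℂ)), IsSLELaw ((8 : ℝ≥0) / 3) D μ →
      IsSLELaw ((8 : ℝ≥0) / 3) (D.map Ψ₂) (μ.map (CurveClass.map (Ψ₂ : C(ℂ, ℂ))))) :
    ∀ (D : DobrushinDomain) (μ : Measure (CurveClass ℂ)), IsSLELaw ((8 : ℝ≥0) / 3) D μ →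
      IsSLELaw ((8 : ℝ≥0) / 3) (D.map (Ψ₁.trans Ψ₂))
        (μ.map (CurveClass.map ((Ψ₁.trans Ψ₂ : ℂ ≃ₜ ℂ) : C(ℂ, ℂ)))) := by
  intro D μ hμ
  have h := h₂ (D.map Ψ₁) _ (h₁ D μ hμ)
  rwa [MarkedDomain.map_map, Measure.map_map (CurveClass.measurable_map _)
    (CurveClass.measurable_map _), ← CurveClass.map_homeomorph_trans] at h

/-! ### The stub -/

/-- **Linear pinning** (stub of line `pin-the-shear`, crux stmt-CriticalPhenomena-14221). Given
stretch rigidity of the chordal SLE(8/3) law family (`SAWBrickWallHomotopy.StretchRigidity`, item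
stmt-CriticalPhenomena-5793), every real-linear plane homeomorphism of positive determinant which
pushes every chordal SLE(8/3) law to a chordal SLE(8/3) law of the image domain is a
rotation-dilation: `m₁₁ = m₂₂` and `m₁₂ = -m₂₁`, i.e. `z ↦ (m₁₁ + i m₂₁) z`. The SLE(8/3)
covariances contain the rotation-dilations (`isSLELaw_map_similarity_eightThirds`) and compose
(`isSLELaw_map_trans_eightThirds`), so the abstract rigidity lemma `eq_zero_of_stretchRigid_class`
applies to the complex form `z ↦ A z + B z̄` of the map (`linear_eq_mul_add_mul_conj`;
`|A|² − |B|² = det > 0`) and gives `B = 0`. [folklore] -/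
theorem stub_linearPinning :
    SAWBrickWallHomotopy.StretchRigidity →
    ∀ m₁₁ m₁₂ m₂₁ m₂₂ : ℝ, 0 < m₁₁ * m₂₂ - m₁₂ * m₂₁ → ∀ Φ : ℂ ≃ₜ ℂ,
      (∀ z : ℂ, Φ z = ((m₁₁ * z.re + m₁₂ * z.im : ℝ) : ℂ) +
          ((m₂₁ * z.re + m₂₂ * z.im : ℝ) : ℂ) * Complex.I) →
      (∀ (D : DobrushinDomain) (μ : Measure (CurveClass ℂ)),
          IsSLELaw ((8 : ℝ≥0) / 3) D μ →
            IsSLELaw ((8 : ℝ≥0) / 3) (D.map Φ) (μ.map (CurveClass.map (Φ : C(ℂ, ℂ))))) →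
      m₁₁ = m₂₂ ∧ m₁₂ = -m₂₁ := by
  intro hSR m₁₁ m₁₂ m₂₁ m₂₂ hdet Φ hΦ hcov
  set A : ℂ := ⟨(m₁₁ + m₂₂) / 2, (m₂₁ - m₁₂) / 2⟩ with hA
  set B : ℂ := ⟨(m₁₁ - m₂₂) / 2, (m₂₁ + m₁₂) / 2⟩ with hB
  have hΦ' : ∀ z : ℂ, Φ z = A * z + B * conj z := fun z =>
    (hΦ z).trans (linear_eq_mul_add_mul_conj m₁₁ m₁₂ m₂₁ m₂₂ z)
  have hnormSq : Complex.normSq A - Complex.normSq B = m₁₁ * m₂₂ - m₁₂ * m₂₁ := by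
    rw [hA, hB, Complex.normSq_mk, Complex.normSq_mk]
    ring
  have hAB : ‖B‖ < ‖A‖ := by
    have h2 : ‖B‖ ^ 2 < ‖A‖ ^ 2 := by
      rw [Complex.sq_norm, Complex.sq_norm]
      linarith
    exact lt_of_pow_lt_pow_left₀ 2 (norm_nonneg A) h2
  have hB0 : B = 0 :=
    eq_zero_of_stretchRigid_class
      (P := fun Ψ : ℂ ≃ₜ ℂ => ∀ (D : DobrushinDomain) (μ : Measure (CurveClass ℂ)),
        IsSLELaw ((8 : ℝ≥0) / 3) D μ →
          IsSLELaw ((8 : ℝ≥0) / 3) (D.map Ψ) (μ.map (CurveClass.map (Ψ : C(ℂ, ℂ)))))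
      isSLELaw_map_similarity_eightThirds isSLELaw_map_trans_eightThirds hSR hAB hΦ' hcov
  have h1 : (m₁₁ - m₂₂) / 2 = 0 := by simpa [hB] using congrArg Complex.re hB0
  have h2 : (m₂₁ + m₁₂) / 2 = 0 := by simpa [hB] using congrArg Complex.im hB0
  constructor <;> linarith

end Summit.CriticalPhenomena.SAWScalingLimit.Cruxes.HexTransfer.PinTheShear

end
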